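import Literature.Barriers.PneNP.TSPExtensionComplexityTours
import Literature.Barriers.PneNP.TSPExtensionComplexityGadgetGraph
import HarnessLib

/-!
# The TSP gadget graph: how a tour traverses an exclusive-or gadget, a chain, a triangle

Support file for the discharge of `Literature.Barriers.PneNP.TSPExtensionComplexity` (FMPTW
2015, Thm. 12). For a tour `T` of the complete graph on `GV n pad` all of whose edges are edges
of `gadgetGraph n pad` (sibling file `…GadgetGraph.lean`) we derive, using only degree two
(`IsTourOn.both_mem`, `IsTourOn.switch3`) and subtour elimination
(`IsTourOn.not_cycEdges_subset`) from `…Tours.lean`: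

* `vert_mem`: the middle vertices force both vertical edges of every column;
* `top_switch` / `bot_switch`: every row vertex uses exactly one of its two row edges, so the
  entry edge `{x i j 0 0, ancL i j}` (resp. `{x i j 2 0, chL i j}`) determines the whole top
  (resp. bottom) row, and leaves at the far end iff it entered (`top_pattern`, `bot_pattern`);
* `xor_gadget`: a tour enters the bottom row from the chain iff it does NOT enter the top row
  from the anchor (two excluded 6-cycles) — Papadimitriou's exclusive-or gadget;
* `chain_iff`: along the chain of bit `i` all gadgets `X_(i,j)` agree, so
  `{x i j 0 0, ancL i j} ∈ T ↔ {x i 0 2 0, g i false} ∉ T` (=: bit `B_i` of the tour);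
* `not_rp_of_bits`: for `i < j`, if `B_i` and `B_j` then the plain edge `{R, P}` of the pair's
  triangle is NOT a tour edge (otherwise the two top rows and `R–P` close a 27-cycle).

`topPath i j` / `botPath i j` are the serpentine traversals of `X_(i,j)` entered from the top /
bottom row; they reappear in the explicit tours of `…GadgetTours.lean`. All [folklore].
-/

namespace Literature.Barriers.PneNP

open GV Finset

variable {n pad : ℕ}

/-! ### Concrete values of the row-neighbour functions -/

section values

variable (i j : Fin n)

/-- [folklore] -/ theorem tPrev_zero : (tPrev i j 0 : GV n pad) = ancL i j := by simp [tPrev]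
/-- [folklore] -/ theorem tPrev_one : (tPrev i j 1 : GV n pad) = x i j 0 0 := by
  simp [tPrev]
/-- [folklore] -/ theorem tPrev_two : (tPrev i j 2 : GV n pad) = x i j 0 1 := by
  simp only [tPrev]; rfl
/-- [folklore] -/ theorem tPrev_three : (tPrev i j 3 : GV n pad) = x i j 0 2 := by
  simp only [tPrev]; rfl
/-- [folklore] -/ theorem tNext_zero : (tNext i j 0 : GV n pad) = x i j 0 1 := by
  simp only [tNext]; rfl
/-- [folklore] -/ theorem tNext_one : (tNext i j 1 : GV n pad) = x i j 0 2 := by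
  simp only [tNext]; rfl
/-- [folklore] -/ theorem tNext_two : (tNext i j 2 : GV n pad) = x i j 0 3 := by
  simp only [tNext]; rfl
/-- [folklore] -/ theorem tNext_three : (tNext i j 3 : GV n pad) = ancR i j := by simp [tNext]
/-- [folklore] -/ theorem sPrev_zero : (sPrev i j 0 : GV n pad) = chL i j := by simp [sPrev]
/-- [folklore] -/ theorem sPrev_one : (sPrev i j 1 : GV n pad) = x i j 2 0 := by
  simp [sPrev]
/-- [folklore] -/ theorem sPrev_two : (sPrev i j 2 : GV n pad) = x i j 2 1 := by
  simp only [sPrev]; rfl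
/-- [folklore] -/ theorem sPrev_three : (sPrev i j 3 : GV n pad) = x i j 2 2 := by
  simp only [sPrev]; rfl
/-- [folklore] -/ theorem sNext_zero : (sNext i j 0 : GV n pad) = x i j 2 1 := by
  simp only [sNext]; rfl
/-- [folklore] -/ theorem sNext_one : (sNext i j 1 : GV n pad) = x i j 2 2 := by
  simp only [sNext]; rfl
/-- [folklore] -/ theorem sNext_two : (sNext i j 2 : GV n pad) = x i j 2 3 := by
  simp only [sNext]; rfl
/-- [folklore] -/ theorem sNext_three : (sNext i j 3 : GV n pad) = chR i j := by simp [sNext]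

/-- `chL i 0 = g i false`. [folklore] -/
theorem chL_zero (h : (j : ℕ) = 0) : (chL i j : GV n pad) = g i false := by simp [chL, h]

/-- `chR i (n-1) = g i true`. [folklore] -/
theorem chR_last (h : (j : ℕ) + 1 = n) : (chR i j : GV n pad) = g i true := by simp [chR, h]

/-- `chL i (j+1) = x i j 2 3`. [folklore] -/
theorem chL_succ (j' : Fin n) (h : (j' : ℕ) = j + 1) : (chL i j' : GV n pad) = x i j 2 3 := by
  rw [chL_eq_x_iff]; exact ⟨rfl, by omega, rfl, rfl⟩

/-- `chR i j = x i (j+1) 2 0`. [folklore] -/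
theorem chR_eq_succ (j' : Fin n) (h : (j' : ℕ) = j + 1) : (chR i j : GV n pad) = x i j' 2 0 := by
  rw [chR_eq_x_iff]; exact ⟨rfl, h, rfl, rfl⟩

/-- `ancL i j = a i j 0` for `i ≤ j`. [folklore] -/
theorem ancL_of_le (h : i ≤ j) : (ancL i j : GV n pad) = a i j 0 := by simp [ancL, h]
/-- `ancR i j = a i j 1` for `i ≤ j`. [folklore] -/
theorem ancR_of_le (h : i ≤ j) : (ancR i j : GV n pad) = a i j 1 := by simp [ancR, h]
/-- `ancL j i = a i j 1` for `i < j`. [folklore] -/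
theorem ancL_of_gt (h : i < j) : (ancL j i : GV n pad) = a i j 1 := by simp [ancL, not_le.2 h]
/-- `ancR j i = a i j 2` for `i < j`. [folklore] -/
theorem ancR_of_gt (h : i < j) : (ancR j i : GV n pad) = a i j 2 := by simp [ancR, not_le.2 h]

/-! ### Distinctness of the three listed neighbours -/

/-- [folklore] -/
theorem mid_ne_tPrev (c : Fin 4) : (x i j 1 c : GV n pad) ≠ tPrev i j c := fun h => by
  have := ((tPrev_eq_x_iff _ _ _ _ _ _ _).1 h.symm).2.2.1
  exact absurd this (by decide)

/-- [folklore] -/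
theorem mid_ne_tNext (c : Fin 4) : (x i j 1 c : GV n pad) ≠ tNext i j c := fun h => by
  have := ((tNext_eq_x_iff _ _ _ _ _ _ _).1 h.symm).2.2.1
  exact absurd this (by decide)

/-- [folklore] -/
theorem mid_ne_sPrev (c : Fin 4) : (x i j 1 c : GV n pad) ≠ sPrev i j c := fun h => by
  rcases (sPrev_eq_x_iff _ _ _ _ _ _ _).1 h.symm with h | h
  · exact absurd h.2.2.2.1 (by decide)
  · exact absurd h.2.2.2.1 (by decide)

/-- [folklore] -/
theorem mid_ne_sNext (c : Fin 4) : (x i j 1 c : GV n pad) ≠ sNext i j c := fun h => by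
  rcases (sNext_eq_x_iff _ _ _ _ _ _ _).1 h.symm with h | h
  · exact absurd h.2.2.2.1 (by decide)
  · exact absurd h.2.2.2.1 (by decide)

/-- [folklore] -/
theorem tPrev_ne_tNext (c : Fin 4) : (tPrev i j c : GV n pad) ≠ tNext i j c := by
  intro h
  by_cases hc : (c : ℕ) = 3
  · have h1 : (tNext i j c : GV n pad) = ancR i j := by simp [tNext, hc]
    have h2 : (tPrev i j c : GV n pad) = x i j 0 ⟨(c : ℕ) - 1, by omega⟩ := by
      simp [tPrev, show (c : ℕ) ≠ 0 by omega]
    rw [h1, h2] at h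
    exact ancR_ne_x _ _ _ _ _ _ h.symm
  · have h1 : (tNext i j c : GV n pad) = x i j 0 ⟨(c : ℕ) + 1, by omega⟩ := by simp [tNext, hc]
    rw [h1, tPrev_eq_x_iff] at h
    have := h.2.2.2
    simp only at this
    omega

/-- [folklore] -/
theorem sPrev_ne_sNext (c : Fin 4) : (sPrev i j c : GV n pad) ≠ sNext i j c := by
  intro h
  by_cases hc : (c : ℕ) = 3
  · have h1 : (sNext i j c : GV n pad) = chR i j := by simp [sNext, hc]
    have h2 : (sPrev i j c : GV n pad) = x i j 2 ⟨(c : ℕ) - 1, by omega⟩ := by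
      simp [sPrev, show (c : ℕ) ≠ 0 by omega]
    rw [h1, h2] at h
    obtain ⟨-, h', -, -⟩ := (chR_eq_x_iff _ _ _ _ _ _).1 h.symm
    omega
  · have h1 : (sNext i j c : GV n pad) = x i j 2 ⟨(c : ℕ) + 1, by omega⟩ := by simp [sNext, hc]
    rw [h1, sPrev_eq_x_iff] at h
    rcases h with ⟨-, -, h, -, -⟩ | ⟨-, -, -, -, h⟩
    · omega
    · simp only at h; omega

end values

/-! ### The serpentine traversals -/

/-- Traversal of `X_(i,j)` entered at the top-left and left at the top-right (top row "used"):
`t₀ m₀ s₀ s₁ m₁ t₁ t₂ m₂ s₂ s₃ m₃ t₃`. [folklore] -/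
def topPath (i j : Fin n) : List (GV n pad) :=
  [x i j 0 0, x i j 1 0, x i j 2 0, x i j 2 1, x i j 1 1, x i j 0 1,
   x i j 0 2, x i j 1 2, x i j 2 2, x i j 2 3, x i j 1 3, x i j 0 3]

/-- Traversal of `X_(i,j)` entered at the bottom-left and left at the bottom-right (bottom row
"used"): `s₀ m₀ t₀ t₁ m₁ s₁ s₂ m₂ t₂ t₃ m₃ s₃`. [folklore] -/
def botPath (i j : Fin n) : List (GV n pad) :=
  [x i j 2 0, x i j 1 0, x i j 0 0, x i j 0 1, x i j 1 1, x i j 2 1,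
   x i j 2 2, x i j 1 2, x i j 0 2, x i j 0 3, x i j 1 3, x i j 2 3]

/-- Members of `topPath i j` are the vertices of `X_(i,j)`. [folklore] -/
theorem mem_topPath_iff {i j : Fin n} {v : GV n pad} :
    v ∈ topPath i j ↔ ∃ r c, v = x i j r c := by
  constructor
  · intro h
    simp only [topPath, List.mem_cons, List.not_mem_nil, or_false] at h
    rcases h with h | h | h | h | h | h | h | h | h | h | h | h <;> exact ⟨_, _, h⟩
  · rintro ⟨r, c, rfl⟩
    have hr : (r : ℕ) = 0 ∨ (r : ℕ) = 1 ∨ (r : ℕ) = 2 := by omega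
    have hc : (c : ℕ) = 0 ∨ (c : ℕ) = 1 ∨ (c : ℕ) = 2 ∨ (c : ℕ) = 3 := by omega
    simp only [topPath, List.mem_cons, List.not_mem_nil, or_false, GV.x.injEq, true_and,
      Fin.ext_iff]
    simp only [Fin.val_zero, Fin.val_one, Fin.val_two, show ((3 : Fin 4) : ℕ) = 3 from rfl]
    omega

/-- Members of `botPath i j` are the vertices of `X_(i,j)`. [folklore] -/
theorem mem_botPath_iff {i j : Fin n} {v : GV n pad} :
    v ∈ botPath i j ↔ ∃ r c, v = x i j r c := by
  constructor
  · intro h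
    simp only [botPath, List.mem_cons, List.not_mem_nil, or_false] at h
    rcases h with h | h | h | h | h | h | h | h | h | h | h | h <;> exact ⟨_, _, h⟩
  · rintro ⟨r, c, rfl⟩
    have hr : (r : ℕ) = 0 ∨ (r : ℕ) = 1 ∨ (r : ℕ) = 2 := by omega
    have hc : (c : ℕ) = 0 ∨ (c : ℕ) = 1 ∨ (c : ℕ) = 2 ∨ (c : ℕ) = 3 := by omega
    simp only [botPath, List.mem_cons, List.not_mem_nil, or_false, GV.x.injEq, true_and,
      Fin.ext_iff]
    simp only [Fin.val_zero, Fin.val_one, Fin.val_two, show ((3 : Fin 4) : ℕ) = 3 from rfl]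
    omega

/-- `topPath` has no repetition. [folklore] -/
theorem nodup_topPath (i j : Fin n) : (topPath i j : List (GV n pad)).Nodup := by
  simp [topPath]

/-- `botPath` has no repetition. [folklore] -/
theorem nodup_botPath (i j : Fin n) : (botPath i j : List (GV n pad)).Nodup := by
  simp [botPath]

/-- [folklore] -/ theorem length_topPath (i j : Fin n) : (topPath i j : List (GV n pad)).length = 12 := rfl
/-- [folklore] -/ theorem length_botPath (i j : Fin n) : (botPath i j : List (GV n pad)).length = 12 := rfl
/-- [folklore] -/ theorem topPath_ne_nil (i j : Fin n) : (topPath i j : List (GV n pad)) ≠ [] := by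
  simp [topPath]
/-- [folklore] -/ theorem botPath_ne_nil (i j : Fin n) : (botPath i j : List (GV n pad)) ≠ [] := by
  simp [botPath]
/-- [folklore] -/ theorem head_topPath (i j : Fin n) :
    (topPath i j : List (GV n pad)).head (topPath_ne_nil i j) = x i j 0 0 := rfl
/-- [folklore] -/ theorem getLast_topPath (i j : Fin n) :
    (topPath i j : List (GV n pad)).getLast (topPath_ne_nil i j) = x i j 0 3 := rfl
/-- [folklore] -/ theorem head_botPath (i j : Fin n) :
    (botPath i j : List (GV n pad)).head (botPath_ne_nil i j) = x i j 2 0 := rfl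
/-- [folklore] -/ theorem getLast_botPath (i j : Fin n) :
    (botPath i j : List (GV n pad)).getLast (botPath_ne_nil i j) = x i j 2 3 := rfl
/-- [folklore] -/ theorem head?_topPath (i j : Fin n) :
    (topPath i j : List (GV n pad)).head? = some (x i j 0 0) := rfl
/-- [folklore] -/ theorem getLast?_topPath (i j : Fin n) :
    (topPath i j : List (GV n pad)).getLast? = some (x i j 0 3) := rfl
/-- [folklore] -/ theorem head?_botPath (i j : Fin n) :
    (botPath i j : List (GV n pad)).head? = some (x i j 2 0) := rfl
/-- [folklore] -/ theorem getLast?_botPath (i j : Fin n) :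
    (botPath i j : List (GV n pad)).getLast? = some (x i j 2 3) := rfl

/-- Consecutive vertices of `topPath` are adjacent in the gadget graph. [folklore] -/
theorem isChain_adj_topPath (i j : Fin n) :
    List.IsChain (gadgetGraph n pad).Adj (topPath i j) := by
  simp only [topPath, List.isChain_cons_cons, List.IsChain.singleton, and_true]
  exact ⟨adj_top_iff.2 (Or.inl rfl), adj_mid_iff.2 (Or.inr rfl),
    adj_bot_iff.2 (Or.inr (Or.inr (sNext_zero i j).symm)), adj_bot_iff.2 (Or.inl rfl),
    adj_mid_iff.2 (Or.inl rfl), adj_top_iff.2 (Or.inr (Or.inr (tNext_one i j).symm)),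
    adj_top_iff.2 (Or.inl rfl), adj_mid_iff.2 (Or.inr rfl),
    adj_bot_iff.2 (Or.inr (Or.inr (sNext_two i j).symm)), adj_bot_iff.2 (Or.inl rfl),
    adj_mid_iff.2 (Or.inl rfl)⟩

/-- Consecutive vertices of `botPath` are adjacent in the gadget graph. [folklore] -/
theorem isChain_adj_botPath (i j : Fin n) :
    List.IsChain (gadgetGraph n pad).Adj (botPath i j) := by
  simp only [botPath, List.isChain_cons_cons, List.IsChain.singleton, and_true]
  exact ⟨adj_bot_iff.2 (Or.inl rfl), adj_mid_iff.2 (Or.inl rfl),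
    adj_top_iff.2 (Or.inr (Or.inr (tNext_zero i j).symm)), adj_top_iff.2 (Or.inl rfl),
    adj_mid_iff.2 (Or.inr rfl), adj_bot_iff.2 (Or.inr (Or.inr (sNext_one i j).symm)),
    adj_bot_iff.2 (Or.inl rfl), adj_mid_iff.2 (Or.inl rfl),
    adj_top_iff.2 (Or.inr (Or.inr (tNext_two i j).symm)), adj_top_iff.2 (Or.inl rfl),
    adj_mid_iff.2 (Or.inr rfl)⟩

/-! ### A tour through the gadget graph -/

section tour

variable {T : Finset (Sym2 (GV n pad))}
  (hT : IsTourOn T) (hTG : ∀ e ∈ T, e ∈ (gadgetGraph n pad).edgeSet)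
include hT hTG

/-- **Verticals are forced**: both edges at a middle vertex are tour edges. [folklore] -/
theorem vert_mem (i j : Fin n) (c : Fin 4) :
    s(x i j 1 c, x i j 0 c) ∈ T ∧ s(x i j 1 c, x i j 2 c) ∈ T :=
  hT.both_mem hTG fun _ hw => adj_mid_iff.1 hw

/-- **Top-row switch**: a top vertex uses exactly one of its two row edges. [folklore] -/
theorem top_switch (i j : Fin n) (c : Fin 4) :
    s(x i j 0 c, tPrev i j c) ∈ T ↔ s(x i j 0 c, tNext i j c) ∉ T :=
  hT.switch3 hTG (fun _ hw => adj_top_iff.1 hw)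
    (by rw [Sym2.eq_swap]; exact (vert_mem hT hTG i j c).1)
    (mid_ne_tPrev i j c) (mid_ne_tNext i j c) (tPrev_ne_tNext i j c)

/-- **Bottom-row switch**. [folklore] -/
theorem bot_switch (i j : Fin n) (c : Fin 4) :
    s(x i j 2 c, sPrev i j c) ∈ T ↔ s(x i j 2 c, sNext i j c) ∉ T :=
  hT.switch3 hTG (fun _ hw => adj_bot_iff.1 hw)
    (by rw [Sym2.eq_swap]; exact (vert_mem hT hTG i j c).2)
    (mid_ne_sPrev i j c) (mid_ne_sNext i j c) (sPrev_ne_sNext i j c)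

/-- **The top row is determined by its entry edge** `A = {t₀, ancL}`:
`t₀t₁ ↔ ¬A`, `t₁t₂ ↔ A`, `t₂t₃ ↔ ¬A`, `{t₃, ancR} ↔ A`. [folklore] -/
theorem top_pattern (i j : Fin n) :
    (s(x i j 0 0, x i j 0 1) ∈ T ↔ s(x i j 0 0, ancL i j) ∉ T) ∧
    (s(x i j 0 1, x i j 0 2) ∈ T ↔ s(x i j 0 0, ancL i j) ∈ T) ∧
    (s(x i j 0 2, x i j 0 3) ∈ T ↔ s(x i j 0 0, ancL i j) ∉ T) ∧
    (s(x i j 0 3, ancR i j) ∈ T ↔ s(x i j 0 0, ancL i j) ∈ T) := by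
  have s0 := top_switch hT hTG i j 0
  have s1 := top_switch hT hTG i j 1
  have s2 := top_switch hT hTG i j 2
  have s3 := top_switch hT hTG i j 3
  rw [tPrev_zero, tNext_zero] at s0
  rw [tPrev_one, tNext_one, Sym2.eq_swap] at s1
  rw [tPrev_two, tNext_two, Sym2.eq_swap] at s2
  rw [tPrev_three, tNext_three, Sym2.eq_swap] at s3
  tauto

/-- **The bottom row is determined by its entry edge** `A' = {s₀, chL}`. [folklore] -/
theorem bot_pattern (i j : Fin n) :
    (s(x i j 2 0, x i j 2 1) ∈ T ↔ s(x i j 2 0, chL i j) ∉ T) ∧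
    (s(x i j 2 1, x i j 2 2) ∈ T ↔ s(x i j 2 0, chL i j) ∈ T) ∧
    (s(x i j 2 2, x i j 2 3) ∈ T ↔ s(x i j 2 0, chL i j) ∉ T) ∧
    (s(x i j 2 3, chR i j) ∈ T ↔ s(x i j 2 0, chL i j) ∈ T) := by
  have s0 := bot_switch hT hTG i j 0
  have s1 := bot_switch hT hTG i j 1
  have s2 := bot_switch hT hTG i j 2
  have s3 := bot_switch hT hTG i j 3
  rw [sPrev_zero, sNext_zero] at s0
  rw [sPrev_one, sNext_one, Sym2.eq_swap] at s1
  rw [sPrev_two, sNext_two, Sym2.eq_swap] at s2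
  rw [sPrev_three, sNext_three, Sym2.eq_swap] at s3
  tauto

/-- **Six-cycle exclusion**: the top and bottom row edges over the same pair of columns are not
both tour edges (with the four verticals they would close the cycle
`t_c t_{c+1} m_{c+1} s_{c+1} s_c m_c`). [folklore] -/
theorem not_both_rows (i j : Fin n) (c c' : Fin 4) (hcc' : (c' : ℕ) = c + 1) :
    ¬(s(x i j 0 c, x i j 0 c') ∈ T ∧ s(x i j 2 c, x i j 2 c') ∈ T) := by
  rintro ⟨h1, h2⟩
  have hcne : c ≠ c' := fun h => by subst h; omega
  have hn : 0 < n := i.pos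
  refine hT.not_cycEdges_subset
    (m := [x i j 0 c, x i j 0 c', x i j 1 c', x i j 2 c', x i j 2 c, x i j 1 c]) ?_ (by simp) ?_ ?_
  · simp [hcne, Ne.symm hcne]
  · rw [GV.card]; simp only [List.length_cons, List.length_nil]; nlinarith
  · refine cycEdges_subset_of_isChain (by simp) ?_ ?_
    · simp only [List.isChain_cons_cons, List.IsChain.singleton, and_true]
      refine ⟨h1, ?_, ?_, ?_, ?_⟩
      · rw [Sym2.eq_swap]; exact (vert_mem hT hTG i j c').1
      · exact (vert_mem hT hTG i j c').2
      · rw [Sym2.eq_swap]; exact h2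
      · rw [Sym2.eq_swap]; exact (vert_mem hT hTG i j c).2
    · exact (vert_mem hT hTG i j c).1

/-- **Exclusive or.** The bottom row of `X_(i,j)` is entered from the chain iff the top row is
not entered from its anchor. [folklore] -/
theorem xor_gadget (i j : Fin n) :
    s(x i j 2 0, chL i j) ∈ T ↔ s(x i j 0 0, ancL i j) ∉ T := by
  have ht := top_pattern hT hTG i j
  have hb := bot_pattern hT hTG i j
  have c0 := not_both_rows hT hTG i j 0 1 rfl
  have c1 := not_both_rows hT hTG i j 1 2 rfl
  constructor
  · intro hA' hA
    exact c1 ⟨ht.2.1.2 hA, hb.2.1.2 hA'⟩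
  · intro hnA
    by_contra hnA'
    exact c0 ⟨ht.1.2 hnA, hb.1.2 hnA'⟩

/-- In top mode (`{t₀, ancL} ∈ T`) the serpentine `topPath` consists of tour edges, and the
row is left through `{t₃, ancR}`. [folklore] -/
theorem top_mode (i j : Fin n) (hA : s(x i j 0 0, ancL i j) ∈ T) :
    List.IsChain (fun u v => s(u, v) ∈ T) (topPath i j) ∧ s(x i j 0 3, ancR i j) ∈ T := by
  have ht := top_pattern hT hTG i j
  have hb := bot_pattern hT hTG i j
  have hx := xor_gadget hT hTG i j
  have hv := vert_mem hT hTG i j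
  refine ⟨?_, ht.2.2.2.2 hA⟩
  simp only [topPath, List.isChain_cons_cons, List.IsChain.singleton, and_true]
  refine ⟨?_, (hv 0).2, ?_, ?_, ?_, ?_, ?_, (hv 2).2, ?_, ?_, ?_⟩
  · rw [Sym2.eq_swap]; exact (hv 0).1
  · exact hb.1.2 (fun h => hx.1 h hA)
  · rw [Sym2.eq_swap]; exact (hv 1).2
  · exact (hv 1).1
  · exact ht.2.1.2 hA
  · rw [Sym2.eq_swap]; exact (hv 2).1
  · exact hb.2.2.1.2 (fun h => hx.1 h hA)
  · rw [Sym2.eq_swap]; exact (hv 3).2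
  · exact (hv 3).1

/-- In bottom mode (`{s₀, chL} ∈ T`) the serpentine `botPath` consists of tour edges, and the
row is left through `{s₃, chR}`. [folklore] -/
theorem bot_mode (i j : Fin n) (hA : s(x i j 2 0, chL i j) ∈ T) :
    List.IsChain (fun u v => s(u, v) ∈ T) (botPath i j) ∧ s(x i j 2 3, chR i j) ∈ T := by
  have ht := top_pattern hT hTG i j
  have hb := bot_pattern hT hTG i j
  have hx := xor_gadget hT hTG i j
  have hv := vert_mem hT hTG i j
  refine ⟨?_, hb.2.2.2.2 hA⟩
  simp only [botPath, List.isChain_cons_cons, List.IsChain.singleton, and_true]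
  refine ⟨?_, (hv 0).1, ?_, ?_, ?_, ?_, ?_, (hv 2).1, ?_, ?_, ?_⟩
  · rw [Sym2.eq_swap]; exact (hv 0).2
  · exact ht.1.2 (hx.1 hA)
  · rw [Sym2.eq_swap]; exact (hv 1).1
  · exact (hv 1).2
  · exact hb.2.1.2 hA
  · rw [Sym2.eq_swap]; exact (hv 2).2
  · exact ht.2.2.1.2 (hx.1 hA)
  · rw [Sym2.eq_swap]; exact (hv 3).1
  · exact (hv 3).2

/-! ### Chains -/

/-- One step along the chain of `i`: `X_(i,j+1)` is in bottom mode iff `X_(i,j)` is (they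
share the edge `{s₃(i,j), s₀(i,j+1)}`). [folklore] -/
theorem chain_step (i j j' : Fin n) (h : (j' : ℕ) = j + 1) :
    (s(x i j' 2 0, chL i j') ∈ T ↔ s(x i j 2 0, chL i j) ∈ T) := by
  rw [chL_succ i j j' h, ← (bot_pattern hT hTG i j).2.2.2, chR_eq_succ i j j' h, Sym2.eq_swap]

/-- **The chain of `i` is in one mode**: every `X_(i,j)` is in bottom mode iff `X_(i,0)` is,
i.e. iff the chain's first edge `{s₀(i,0), g i false}` is a tour edge. [folklore] -/
theorem chain_iff (i j : Fin n) :
    (s(x i j 2 0, chL i j) ∈ T ↔ s(x i ⟨0, i.pos⟩ 2 0, g i false) ∈ T) := by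
  obtain ⟨k, hk⟩ := j
  induction k with
  | zero => rw [chL_zero _ _ rfl]
  | succ k ih =>
    rw [chain_step hT hTG i ⟨k, by omega⟩ ⟨k + 1, hk⟩ rfl]
    exact ih (by omega)

/-- **The bit read by every gadget of the chain**: the top row of `X_(i,j)` is entered from its
anchor iff the chain of `i` is NOT used (`B_i`). [folklore] -/
theorem top_entry_iff (i j : Fin n) :
    s(x i j 0 0, ancL i j) ∈ T ↔ s(x i ⟨0, i.pos⟩ 2 0, g i false) ∉ T := by
  rw [← chain_iff hT hTG i j, xor_gadget hT hTG i j, not_not]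

/-! ### Triangles -/

/-- **If both bits of a pair are set, the plain triangle edge `{R, P}` is not a tour edge**:
otherwise `P –X_(i,j)→ Q –X_(j,i)→ R – P` would be a 27-cycle inside the tour. [folklore] -/
theorem not_rp_of_bits (i j : Fin n) (hij : i < j)
    (hBi : s(x i ⟨0, i.pos⟩ 2 0, g i false) ∉ T) (hBj : s(x j ⟨0, j.pos⟩ 2 0, g j false) ∉ T) :
    s(a i j 2, a i j 0) ∉ T := by
  intro hRP
  have hAi : s(x i j 0 0, ancL i j) ∈ T := (top_entry_iff hT hTG i j).2 hBi
  have hAj : s(x j i 0 0, ancL j i) ∈ T := (top_entry_iff hT hTG j i).2 hBj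
  obtain ⟨hci, hZi⟩ := top_mode hT hTG i j hAi
  obtain ⟨hcj, hZj⟩ := top_mode hT hTG j i hAj
  rw [ancL_of_le i j hij.le] at hAi
  rw [ancR_of_le i j hij.le] at hZi
  rw [ancL_of_gt i j hij] at hAj
  rw [ancR_of_gt i j hij] at hZj
  have hne : i ≠ j := hij.ne
  have hne' : j ≠ i := hij.ne'
  refine hT.not_cycEdges_subset
    (m := a i j 0 :: (topPath i j ++ a i j 1 :: (topPath j i ++ [a i j 2]))) ?_ ?_ ?_ ?_
  · -- no repeated vertex
    simp [topPath, hne, hne']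
  · simp [topPath]
  · rw [GV.card]
    simp only [List.length_cons, List.length_append, length_topPath, List.length_nil]
    have : 2 ≤ n := by have := hij; omega
    nlinarith
  · refine cycEdges_subset_of_isChain (by simp) ?_ ?_
    · rw [List.isChain_cons]
      refine ⟨?_, ?_⟩
      · intro y hy
        simp [List.head?_append, head?_topPath] at hy
        subst hy
        rw [Sym2.eq_swap]; exact hAi
      · rw [List.isChain_append]
        refine ⟨hci, ?_, ?_⟩
        · rw [List.isChain_cons]
          refine ⟨?_, ?_⟩
          · intro y hy
            simp [List.head?_append, head?_topPath] at hy
            subst hy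
            rw [Sym2.eq_swap]; exact hAj
          · rw [List.isChain_append]
            refine ⟨hcj, List.isChain_singleton _, ?_⟩
            intro u hu v hv
            simp [getLast?_topPath] at hu hv
            subst hu; subst hv
            exact hZj
        · intro u hu v hv
          simp [getLast?_topPath] at hu hv
          subst hu; subst hv
          exact hZi
    · simpa [topPath, Sym2.eq_swap] using hRP

end tour

end Literature.Barriers.PneNP
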